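/-
Copyright (c) 2026 the pub-hodgecm-mathlib formalisation cell (harness21).  Prover seat hodgecm-mathlib-K2E3-p21 (g2), HCML Track B «K2-LIT» (build stream 29),
h413 = `stmt-HodgeConjecture-24833`, line `K2_E3_EllipticInputs`, unit U3, line U3-d (lead K2E3-p03 (g0)), FILE C ASSEMBLY part 3 (deal `K2/STATUS.md`
2026-09-03T23:50:23Z): THE SCALING LAW ‹SC-explicit› modulo rung C1's transvection Haar head in its FINAL, residue-characteristic-free shape (`(2 : K) ≠ 0`).  2026-09-04.
-/
import Summits.HodgeConjecture.HodgeConjecture.Theorems.K2E3UnipotentOrbitalScalingLaw                -- ★ p855982 (this seat): part 2 (the `Valued.v 2 < 1`-shape head) + `exists_valued_eq_exp_neg`; brings ★ part 1 (prelims)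
import Summits.HodgeConjecture.HodgeConjecture.Theorems.K2E3UnipotentOrbitalScalingRegularHaar         -- ★ p855756 (K2E1b-p01, C2): `exists_haar_index_identity_of_regular_unipotent`
import Summits.HodgeConjecture.HodgeConjecture.Theorems.K2E3LocalLatticeScalingIndex                  -- ★ p855586 (this seat): the index bridges (F1)(F2⁺)(F2⁻) at the place
import Summits.HodgeConjecture.HodgeConjecture.Theorems.K2E3OrbitalScalingDataTransport               -- ★ p855798 (this seat): `exists_scalingData_of_continuousMulEquiv` (model → `Gqs`)
import Summits.HodgeConjecture.HodgeConjecture.Theorems.K2E3UnipotentOrbitalScalingOfIndex            -- ★ p855453 (K2E3-p03): `classOrbitalIntegral_indicator_comp_eq_mul_of_conj_of_index`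
import Summits.HodgeConjecture.HodgeConjecture.Theorems.K2E3CayleyScalingPackage                      -- ★ p855512 (K2E3-p01): the consumer `psiPackage_of_scalingLaw` (its `hSC` is the target here)
import Literature.NumberTheory.Automorphic.LocalUnitaryGroupUnimodularIsotropic                         -- ★ `isMulRightInvariant_cmDatum_local_antidiagOne` (Haar on `U(Φ₃)(L⁺_v)` is two-sided)
import Literature.NumberTheory.Automorphic.LocalUnitaryGroupCongrMeasure                                -- ★ instances: `U(H)(L⁺_v)` locally compact, second countable, Hausdorff
import Literature.NumberTheory.Automorphic.CMLocalNonsplitBorelTransport                                -- ★ `apply_eq_zero_iff_apply_apply_eq_zero` (one place above a non-split `v`)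
import Literature.NumberTheory.Automorphic.AdicCompletionCompact                                         -- ★ `compactSpace_integer_adicCompletion`
import HarnessLib

/-!
# h413 ∕ Track B «K2-LIT», line U3-d, FILE C: THE SCALING LAW OF THE UNIPOTENT ORBITAL INTEGRALS OF `U(Φ₃)(L⁺_v)` — ‹C1 Haar head, `2 ≠ 0` shape› ⟹ ‹SC-explicit›

Cell `pub/hodgecm-mathlib`, crux H413 = `stmt-HodgeConjecture-24833`, route of record `HCCMUnconditional`; chair K2-lead (g0), dealer K2E3-plan, line lead of U3-d K2E3-p03 (g0)
(deal 2026-09-03T23:50:23Z).  THEOREMS ONLY (no `def`, no `instance`, no `notation`, no `sorry`); imports = ★ + HarnessLib; lane `--supports stmt-HodgeConjecture-24833 --as helper`.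

WHY THIS FILE (companion of ★ p855982 `K2E3UnipotentOrbitalScalingLaw`).  ★ p855982 proved ‹SC-explicit› modulo a hypothesis = ★ p855803's transvection Haar head with
`hv2 : Valued.v 2 = 1` replaced by `Valued.v 2 < 1`.  Rung C1's announced residual deliverable (K2E4-p03 (g2), `K2/STATUS.md` 2026-09-04T00:01:14Z) is instead the SAME head with
`hv2` replaced by `h2 : (2 : K) ≠ 0` — valid at EVERY residue characteristic, but not implying the former hypothesis in characteristic `2`.  This file therefore proves the assembly
against THAT shape: `scalingLaw_of_transvectionHaar : ‹C1 Haar head with (2 : K) ≠ 0› → ‹SC-explicit›`, with ‹SC-explicit› TOKEN FOR TOKEN the hypothesis `hSC` of ★ p855512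
`K2E3CayleyScalingPackage.psiPackage_of_scalingLaw` (docking certified by the closing `example`).  When the residual head lands as a theorem `T`, `scalingLaw_of_transvectionHaar
(fun … => T …)` is ‹SC-explicit› unconditionally (no case split on `|2|_w`).  The regular and identity branches are unconditional (★ C2 p855548∕p855756, ★ part 1 p855882).

THE WITNESSES AND THE PROOF are those of ★ p855982 (module docstring there): `w` any place above `v`, `t := p = resChar v ∈ L_w` (`σ_w`-fixed, `0 < |t|_w < 1`, `|t|_w = exp(−k)`),
`s := t·t`, `ρ := 1∕2`, `q := (#𝓀[L_w])^k`, `a u := 0 ∕ 2 ∕ 3` (identity ∕ transvection ∕ otherwise); unipotency of `out u` read at `w`; ★ part 1 for `u₀ ∈ U₀`, `hU`, (E), `Ψ 1 = 1`;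
C1 (here: the hypothesis `hC1`, fed with ★ p855586 (F1)(F2⁻) and `(2 : L_w) ≠ 0`) ∕ ★ C2 (with ★ p855586 (F2⁺)(F2⁻)); ★ p855798 transport; ★ p855453 §2 with a two-sided Haar `ν`
(★ `isMulRightInvariant_cmDatum_local_antidiagOne`) and admissibility of `mU` at `u`.

HONEST LABEL.  HC_CM is proved only modulo the 7 printed citations (2 remaining named inputs: hLiu418 = `stmt-HodgeConjecture-24832`, h413 =
`stmt-HodgeConjecture-24833`) until rung 0 closes.  With this file: #3 ⟸ U3-d ⟸ ‹#3H*› ⟸ ‹Ψ-package› (★ p855512) ⟸ ‹SC-explicit› ⟸ {`hC1` = rung C1's `2 ≠ 0` Haar head} —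
conditional on `hC1` only; count-neutral helper until that head lands.

## References
* [HarishChandra1999AdmissibleDistributions] Harish-Chandra, *Admissible Invariant Distributions on Reductive p-adic Groups*, ULS 16 (1999), §3.1 Lemma 3.2 (homogeneity).
* [Rogawski1990] J. D. Rogawski, *Automorphic Representations of Unitary Groups in Three Variables* (1990), §8.1 Prop. 8.1.2 (b) p. 114; (8.1.1) p. 116; §3.9 p. 32.
* [PlatonovRapinchuk1994] V. Platonov, A. Rapinchuk, *Algebraic Groups and Number Theory* (1994), §3.3, §5.1.
-/

set_option autoImplicit false
set_option linter.dupNamespace false  -- the mandated namespace repeats the single-problem summit's segment (`HodgeConjecture.HodgeConjecture`)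

noncomputable section

open NumberField IsDedekindDomain MeasureTheory Filter Topology Set
open scoped Matrix MatrixGroups ENNReal NNReal Valued WithZero
open Literature.NumberTheory.Rogawski1990 Literature.NumberTheory.Automorphic Literature.NumberTheory.Automorphic.UnitaryGroup
open Literature.NumberTheory.Weil1982.UnitaryFinTopForm Literature.MeasureTheory.Group
open Summit.HodgeConjecture.HodgeConjecture.Cruxes.H413.K2E3UnipotentOrbitalScalingLawPrelims
open Summit.HodgeConjecture.HodgeConjecture.Cruxes.H413.K2E3UnipotentOrbitalScalingLaw (exists_valued_eq_exp_neg)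
open Summit.HodgeConjecture.HodgeConjecture.Cruxes.H413.K2E3UnipotentOrbitalScalingRegularHaar
open Summit.HodgeConjecture.HodgeConjecture.Cruxes.H413.K2E3LocalLatticeScalingIndex
open Summit.HodgeConjecture.HodgeConjecture.Cruxes.H413.K2E3OrbitalScalingDataTransport
open Summit.HodgeConjecture.HodgeConjecture.Cruxes.H413.K2E3UnipotentOrbitalScalingOfIndex
open Summit.HodgeConjecture.HodgeConjecture.Cruxes.H413.K2E3CayleyScalingPackage

namespace Summit.HodgeConjecture.HodgeConjecture.Cruxes.H413.K2E3UnipotentOrbitalScalingLawOfNeZero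

/-! ## The head: ‹C1 Haar head, `2 ≠ 0` shape› ⟹ ‹SC-explicit› -/

set_option maxHeartbeats 1600000 in
/-- **THE SCALING LAW OF THE UNIPOTENT ORBITAL INTEGRALS OF `U(Φ₃)(L⁺_v)`, MODULO RUNG C1's TRANSVECTION HAAR HEAD IN ITS `(2 : K) ≠ 0` SHAPE.**  The conclusion is
‹SC-explicit› = the hypothesis `hSC` of ★ p855512 `psiPackage_of_scalingLaw` TOKEN FOR TOKEN; the hypothesis `hC1` is ★ p855803 `exists_haar_index_identity_of_transvection`
with `hv2 : Valued.v 2 = 1` replaced by `(2 : K) ≠ 0` (rung C1's announced residual head, every residue characteristic).  Witnesses and proof as in ★ p855982.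
[cite: HarishChandra1999AdmissibleDistributions, §3.1 Lemma 3.2] [cite: Rogawski1990, §8.1 Prop. 8.1.2 (b) p. 114] [cite: PlatonovRapinchuk1994, §3.3; §5.1] -/
theorem scalingLaw_of_transvectionHaar
    (hC1 : ∀ {K : Type} [Field K] [Valued K ℤᵐ⁰] (σ : K →+* K) {J : Matrix (Fin 3) (Fin 3) K} [CompactSpace 𝒪[K]] [LocallyCompactSpace K]
      [MeasurableSpace ↥(unitaryGroupOfForm σ J)] [BorelSpace ↥(unitaryGroupOfForm σ J)],
      J = (StdForm.antidiagonal 3).over K → (∀ a : K, σ (σ a) = a) → (∀ a : K, Valued.v (σ a) = Valued.v a) → (2 : K) ≠ 0 →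
      ∀ {t : K}, t ≠ 0 → σ t = t → Valued.v t ≤ 1 →
      ∀ {O : AddSubgroup K}, (∀ x : K, x ∈ O ↔ Valued.v x ≤ 1) → ∀ {Om : AddSubgroup K}, (∀ x : K, x ∈ Om ↔ σ x = -x ∧ Valued.v x ≤ 1) →
      ∀ {Q : ℕ}, (O.map (AddMonoidHom.mulLeft t)).relIndex O = Q → (Om.map (AddMonoidHom.mulLeft (t * t))).relIndex Om = Q →
      ∀ (u₀ : ↥(unitaryGroupOfForm σ J)), (((u₀ : GL (Fin 3) K) : Matrix (Fin 3) (Fin 3) K) - 1) * (((u₀ : GL (Fin 3) K) : Matrix (Fin 3) (Fin 3) K) - 1) = 0 → ((u₀ : GL (Fin 3) K) : Matrix (Fin 3) (Fin 3) K) ≠ 1 →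
      ∃ h : ↥(unitaryGroupOfForm σ J),
        (((h * u₀ * h⁻¹ : ↥(unitaryGroupOfForm σ J)) : GL (Fin 3) K) : Matrix (Fin 3) (Fin 3) K) = cayley ((t * t) • ((((u₀ : GL (Fin 3) K) : Matrix (Fin 3) (Fin 3) K) - 1) * (((u₀ : GL (Fin 3) K) : Matrix (Fin 3) (Fin 3) K) + 1)⁻¹)) ∧
        (∀ z : ↥(unitaryGroupOfForm σ J), z ∈ Subgroup.centralizer ({u₀} : Set ↥(unitaryGroupOfForm σ J)) ↔
          h * z * h⁻¹ ∈ Subgroup.centralizer ({u₀} : Set ↥(unitaryGroupOfForm σ J))) ∧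
        ∃ K₀ : Subgroup ↥(unitaryGroupOfForm σ J), IsOpen (K₀ : Set ↥(unitaryGroupOfForm σ J)) ∧ IsCompact (K₀ : Set ↥(unitaryGroupOfForm σ J)) ∧
          ∃ ρ : Measure ↥(Subgroup.centralizer ({u₀} : Set ↥(unitaryGroupOfForm σ J))),
            ρ.IsMulLeftInvariant ∧ IsFiniteMeasureOnCompacts ρ ∧ ρ.IsOpenPosMeasure ∧
            (((Q : ℝ≥0) ^ 2 : ℝ≥0) : ℝ≥0∞) * ρ (Subtype.val ⁻¹' ((K₀.map (MulAut.conj h).toMonoidHom : Subgroup ↥(unitaryGroupOfForm σ J)) : Set ↥(unitaryGroupOfForm σ J))) =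
              ρ (Subtype.val ⁻¹' (K₀ : Set ↥(unitaryGroupOfForm σ J)))) :
    ∀ (L : Type) [Field L] [NumberField L] [IsCMField L] (v : HeightOneSpectrum (𝓞 ↥(maximalRealSubfield L))),
      (∀ w : PlacesOver L v, IsCMField.complexConj L • w.1 = w.1) →
      ∀ [MeasurableSpace (Gqs L v)] [BorelSpace (Gqs L v)]
        [∀ γ : Gqs L v, MeasurableSpace (Gqs L v ⧸ Subgroup.centralizer ({γ} : Set (Gqs L v)))]
        [∀ γ : Gqs L v, BorelSpace (Gqs L v ⧸ Subgroup.centralizer ({γ} : Set (Gqs L v)))],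
      ∃ (w : PlacesOver L v) (hw : IsCMField.complexConj L • w.1 = w.1) (s : w.1.adicCompletion L) (ρ : ℝ) (q : ℂ) (a : ConjClasses (Gqs L v) → ℕ),
        galAdicCompletionMap (L := L) (IsCMField.complexConj L) hw s = s ∧ s ≠ 0 ∧ ‖s‖ < 1 ∧ 0 < ρ ∧ ρ < 1 ∧ 1 < ‖q‖ ∧
        (∀ u : ConjClasses (Gqs L v), u ≠ ConjClasses.mk 1 → 1 ≤ a u) ∧
        ∀ (Ψ : Gqs L v → Gqs L v) (U₀ : Set (Gqs L v)),
          (∀ γ : Gqs L v, γ ∈ U₀ ↔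
            IsUnit ((((localNonsplitEquiv (IsCMField.complexConj L) (qsForm L) (IsCMField.complexConj_ne_one L) w hw γ : ↥(unitaryGroupOfForm (galAdicCompletionMap (L := L) (IsCMField.complexConj L) hw) (placeForm (qsForm L) w.1))) : GL (Fin 3) (w.1.adicCompletion L)) : Matrix (Fin 3) (Fin 3) (w.1.adicCompletion L)) + 1).det ∧
            ‖(((((localNonsplitEquiv (IsCMField.complexConj L) (qsForm L) (IsCMField.complexConj_ne_one L) w hw γ : ↥(unitaryGroupOfForm (galAdicCompletionMap (L := L) (IsCMField.complexConj L) hw) (placeForm (qsForm L) w.1))) : GL (Fin 3) (w.1.adicCompletion L)) : Matrix (Fin 3) (Fin 3) (w.1.adicCompletion L)) - 1) *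
                ((((localNonsplitEquiv (IsCMField.complexConj L) (qsForm L) (IsCMField.complexConj_ne_one L) w hw γ : ↥(unitaryGroupOfForm (galAdicCompletionMap (L := L) (IsCMField.complexConj L) hw) (placeForm (qsForm L) w.1))) : GL (Fin 3) (w.1.adicCompletion L)) : Matrix (Fin 3) (Fin 3) (w.1.adicCompletion L)) + 1)⁻¹).charpoly.coeff 2‖ ≤ ρ ∧
            ‖(((((localNonsplitEquiv (IsCMField.complexConj L) (qsForm L) (IsCMField.complexConj_ne_one L) w hw γ : ↥(unitaryGroupOfForm (galAdicCompletionMap (L := L) (IsCMField.complexConj L) hw) (placeForm (qsForm L) w.1))) : GL (Fin 3) (w.1.adicCompletion L)) : Matrix (Fin 3) (Fin 3) (w.1.adicCompletion L)) - 1) *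
                ((((localNonsplitEquiv (IsCMField.complexConj L) (qsForm L) (IsCMField.complexConj_ne_one L) w hw γ : ↥(unitaryGroupOfForm (galAdicCompletionMap (L := L) (IsCMField.complexConj L) hw) (placeForm (qsForm L) w.1))) : GL (Fin 3) (w.1.adicCompletion L)) : Matrix (Fin 3) (Fin 3) (w.1.adicCompletion L)) + 1)⁻¹).charpoly.coeff 1‖ ≤ ρ ^ 2 ∧
            ‖(((((localNonsplitEquiv (IsCMField.complexConj L) (qsForm L) (IsCMField.complexConj_ne_one L) w hw γ : ↥(unitaryGroupOfForm (galAdicCompletionMap (L := L) (IsCMField.complexConj L) hw) (placeForm (qsForm L) w.1))) : GL (Fin 3) (w.1.adicCompletion L)) : Matrix (Fin 3) (Fin 3) (w.1.adicCompletion L)) - 1) *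
                ((((localNonsplitEquiv (IsCMField.complexConj L) (qsForm L) (IsCMField.complexConj_ne_one L) w hw γ : ↥(unitaryGroupOfForm (galAdicCompletionMap (L := L) (IsCMField.complexConj L) hw) (placeForm (qsForm L) w.1))) : GL (Fin 3) (w.1.adicCompletion L)) : Matrix (Fin 3) (Fin 3) (w.1.adicCompletion L)) + 1)⁻¹).charpoly.coeff 0‖ ≤ ρ ^ 3) →
          (∀ γ ∈ U₀,
            (((localNonsplitEquiv (IsCMField.complexConj L) (qsForm L) (IsCMField.complexConj_ne_one L) w hw (Ψ γ) : ↥(unitaryGroupOfForm (galAdicCompletionMap (L := L) (IsCMField.complexConj L) hw) (placeForm (qsForm L) w.1))) : GL (Fin 3) (w.1.adicCompletion L)) : Matrix (Fin 3) (Fin 3) (w.1.adicCompletion L)) =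
              cayley (s • (((((localNonsplitEquiv (IsCMField.complexConj L) (qsForm L) (IsCMField.complexConj_ne_one L) w hw γ : ↥(unitaryGroupOfForm (galAdicCompletionMap (L := L) (IsCMField.complexConj L) hw) (placeForm (qsForm L) w.1))) : GL (Fin 3) (w.1.adicCompletion L)) : Matrix (Fin 3) (Fin 3) (w.1.adicCompletion L)) - 1) *
                ((((localNonsplitEquiv (IsCMField.complexConj L) (qsForm L) (IsCMField.complexConj_ne_one L) w hw γ : ↥(unitaryGroupOfForm (galAdicCompletionMap (L := L) (IsCMField.complexConj L) hw) (placeForm (qsForm L) w.1))) : GL (Fin 3) (w.1.adicCompletion L)) : Matrix (Fin 3) (Fin 3) (w.1.adicCompletion L)) + 1)⁻¹))) →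
          ∀ (S : Finset (ConjClasses (Gqs L v))) (mU : OrbitalMeasureFamily (Gqs L v)),
            (∀ u ∈ S, (((Quotient.out u : Gqs L v).val : GL (Fin 3) (UnitaryGroup.LocalRing L v)).val - 1) ^ 3 = 0) →
            mU.IsAdmissibleOn (fun γ : Gqs L v => (ConjClasses.mk γ) ∈ S) →
            ∀ u ∈ S, ∀ F : Gqs L v → ℂ, IsLocSmooth F →
              classOrbitalIntegral mU (U₀.indicator (F ∘ Ψ)) u = q ^ (a u) * classOrbitalIntegral mU F u := by
  intro L _ _ _ v hns _ _ _ _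
  classical
  -- ### the place `w ∣ v`, the local field `K = L_w`, `σ = σ_w`
  obtain ⟨w⟩ := (inferInstance : Nonempty (PlacesOver L v))
  have hw : IsCMField.complexConj L • w.1 = w.1 := hns w
  haveI hquad : Algebra.IsQuadraticExtension ↥(maximalRealSubfield L) L := IsCMField.isQuadraticExtension L
  have hc : IsCMField.complexConj L ≠ 1 := IsCMField.complexConj_ne_one L
  have hσσ : ∀ x : w.1.adicCompletion L, galAdicCompletionMap (L := L) (IsCMField.complexConj L) hw (galAdicCompletionMap (L := L) (IsCMField.complexConj L) hw x) = x :=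
    galAdicCompletionMap_galAdicCompletionMap_of_smul_eq (IsCMField.complexConj L) w hc hw
  have hσv : ∀ a : w.1.adicCompletion L, Valued.v (galAdicCompletionMap (L := L) (IsCMField.complexConj L) hw a) = Valued.v a :=
    fun a => valued_galAdicCompletionMap (L := L) (IsCMField.complexConj L) hw a
  have hJw : placeForm (qsForm L) w.1 = (StdForm.antidiagonal 3).over (w.1.adicCompletion L) := by
    rw [placeForm, Literature.NumberTheory.Rogawski1990.qsForm, antidiagOne_eq_over, StdForm.over_map]
  haveI : CharZero (w.1.adicCompletion L) := charZero_of_injective_algebraMap (algebraMap L (w.1.adicCompletion L)).injective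
  have h2 : (2 : w.1.adicCompletion L) ≠ 0 := two_ne_zero
  -- ### the scalar `t = p`, `k = v_w(p)`, `Q = (#𝓀)^k`
  have ht0 : ((resChar L v : ℕ) : w.1.adicCompletion L) ≠ 0 := Nat.cast_ne_zero.2 (resChar_ne_zero L v)
  have ht1 : Valued.v ((resChar L v : ℕ) : w.1.adicCompletion L) < 1 := valued_natCast_resChar_lt_one L v w
  have hσt : galAdicCompletionMap (L := L) (IsCMField.complexConj L) hw ((resChar L v : ℕ) : w.1.adicCompletion L) = (resChar L v : ℕ) := map_natCast _ _
  obtain ⟨k, hk1, htk⟩ := exists_valued_eq_exp_neg ht0 ht1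
  haveI : Finite (𝓞 L ⧸ w.1.asIdeal) := w.1.asIdeal.finiteQuotientOfFreeOfNeBot w.1.ne_bot
  haveI : Finite 𝓀[w.1.adicCompletion L] := HeightOneSpectrum.finite_residueField_adicCompletion L w.1
  have hQ1 : 1 < Nat.card 𝓀[w.1.adicCompletion L] ^ k := Nat.one_lt_pow (by omega) Finite.one_lt_card
  have hs1 : ‖((resChar L v : ℕ) : w.1.adicCompletion L) * ((resChar L v : ℕ) : w.1.adicCompletion L)‖ < 1 := by
    have h' : ‖((resChar L v : ℕ) : w.1.adicCompletion L)‖ < 1 := Valued.toNormedField.norm_lt_one_iff.2 ht1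
    rw [norm_mul]
    exact mul_lt_one_of_nonneg_of_lt_one_left (norm_nonneg _) h' h'.le
  have hq : 1 < ‖((Nat.card 𝓀[w.1.adicCompletion L] ^ k : ℕ) : ℂ)‖ := by
    rw [Complex.norm_natCast]; exact_mod_cast hQ1
  -- ### the exponents `a u ∈ {0, 2, 3}`
  obtain ⟨a, ha⟩ : ∃ a : ConjClasses (Gqs L v) → ℕ, ∀ u, a u =
      (if ((Quotient.out u : Gqs L v).val : GL (Fin 3) (UnitaryGroup.LocalRing L v)).val = 1 then 0
      else if (((Quotient.out u : Gqs L v).val : GL (Fin 3) (UnitaryGroup.LocalRing L v)).val - 1) ^ 2 = 0 then 2 else 3) := ⟨_, fun _ => rfl⟩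
  have hmk : ∀ u : ConjClasses (Gqs L v), ConjClasses.mk (Quotient.out u : Gqs L v) = u := fun u => by
    rw [← ConjClasses.quotient_mk_eq_mk, Quotient.out_eq]
  have ha1 : ∀ u : ConjClasses (Gqs L v), u ≠ ConjClasses.mk 1 → 1 ≤ a u := by
    intro u hu1
    rw [ha]
    by_cases h1 : ((Quotient.out u : Gqs L v).val : GL (Fin 3) (UnitaryGroup.LocalRing L v)).val = 1
    · exact absurd ((hmk u).symm.trans (by rw [show (Quotient.out u : Gqs L v) = 1 from Subtype.ext (Units.ext h1)])) hu1
    · rw [if_neg h1]; split_ifs <;> omega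
  refine ⟨w, hw, _, 1 / 2, _, a, by rw [map_mul, hσt], mul_ne_zero ht0 ht0, hs1, by norm_num, by norm_num, hq, ha1, ?_⟩
  intro Ψ U₀ hU hΨ S mU hunip hadm u hu F hF
  -- ### the model `M = U(σ_w, J_w)(L_w)`, `e`, the ball `B`
  set e : Gqs L v ≃ₜ* ↥(unitaryGroupOfForm (galAdicCompletionMap (L := L) (IsCMField.complexConj L) hw) (placeForm (qsForm L) w.1)) :=
    localNonsplitEquiv (IsCMField.complexConj L) (qsForm L) (IsCMField.complexConj_ne_one L) w hw with he
  set B : Set ↥(unitaryGroupOfForm (galAdicCompletionMap (L := L) (IsCMField.complexConj L) hw) (placeForm (qsForm L) w.1)) := {m |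
    IsUnit (((m : GL (Fin 3) (w.1.adicCompletion L)) : Matrix (Fin 3) (Fin 3) (w.1.adicCompletion L)) + 1).det ∧
    ‖((((m : GL (Fin 3) (w.1.adicCompletion L)) : Matrix (Fin 3) (Fin 3) (w.1.adicCompletion L)) - 1) *
        (((m : GL (Fin 3) (w.1.adicCompletion L)) : Matrix (Fin 3) (Fin 3) (w.1.adicCompletion L)) + 1)⁻¹).charpoly.coeff 2‖ ≤ 1 / 2 ∧
    ‖((((m : GL (Fin 3) (w.1.adicCompletion L)) : Matrix (Fin 3) (Fin 3) (w.1.adicCompletion L)) - 1) *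
        (((m : GL (Fin 3) (w.1.adicCompletion L)) : Matrix (Fin 3) (Fin 3) (w.1.adicCompletion L)) + 1)⁻¹).charpoly.coeff 1‖ ≤ (1 / 2) ^ 2 ∧
    ‖((((m : GL (Fin 3) (w.1.adicCompletion L)) : Matrix (Fin 3) (Fin 3) (w.1.adicCompletion L)) - 1) *
        (((m : GL (Fin 3) (w.1.adicCompletion L)) : Matrix (Fin 3) (Fin 3) (w.1.adicCompletion L)) + 1)⁻¹).charpoly.coeff 0‖ ≤ (1 / 2) ^ 3} with hBdef
  have hB : ∀ m : ↥(unitaryGroupOfForm (galAdicCompletionMap (L := L) (IsCMField.complexConj L) hw) (placeForm (qsForm L) w.1)), m ∈ B ↔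
      IsUnit (((m : GL (Fin 3) (w.1.adicCompletion L)) : Matrix (Fin 3) (Fin 3) (w.1.adicCompletion L)) + 1).det ∧
      ‖((((m : GL (Fin 3) (w.1.adicCompletion L)) : Matrix (Fin 3) (Fin 3) (w.1.adicCompletion L)) - 1) *
          (((m : GL (Fin 3) (w.1.adicCompletion L)) : Matrix (Fin 3) (Fin 3) (w.1.adicCompletion L)) + 1)⁻¹).charpoly.coeff 2‖ ≤ 1 / 2 ∧
      ‖((((m : GL (Fin 3) (w.1.adicCompletion L)) : Matrix (Fin 3) (Fin 3) (w.1.adicCompletion L)) - 1) *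
          (((m : GL (Fin 3) (w.1.adicCompletion L)) : Matrix (Fin 3) (Fin 3) (w.1.adicCompletion L)) + 1)⁻¹).charpoly.coeff 1‖ ≤ (1 / 2) ^ 2 ∧
      ‖((((m : GL (Fin 3) (w.1.adicCompletion L)) : Matrix (Fin 3) (Fin 3) (w.1.adicCompletion L)) - 1) *
          (((m : GL (Fin 3) (w.1.adicCompletion L)) : Matrix (Fin 3) (Fin 3) (w.1.adicCompletion L)) + 1)⁻¹).charpoly.coeff 0‖ ≤ (1 / 2) ^ 3 := fun _ => Iff.rfl
  have hU₀ : ∀ γ : Gqs L v, γ ∈ U₀ ↔ e γ ∈ B := hU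
  have hρ0 : (0 : ℝ) ≤ 1 / 2 := by norm_num
  have hsρ : ‖((resChar L v : ℕ) : w.1.adicCompletion L) * ((resChar L v : ℕ) : w.1.adicCompletion L)‖ * (1 / 2) < 1 := by
    nlinarith [norm_nonneg (((resChar L v : ℕ) : w.1.adicCompletion L) * ((resChar L v : ℕ) : w.1.adicCompletion L))]
  -- ### the representative `u₀ = out u`, unipotent at `w`
  have hpow : ∀ n : ℕ, ((((e (Quotient.out u) : ↥(unitaryGroupOfForm (galAdicCompletionMap (L := L) (IsCMField.complexConj L) hw) (placeForm (qsForm L) w.1))) :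
        GL (Fin 3) (w.1.adicCompletion L)) : Matrix (Fin 3) (Fin 3) (w.1.adicCompletion L)) - 1) ^ n =
      (Pi.evalRingHom (fun w' : PlacesOver L v => w'.1.adicCompletion L) w).mapMatrix
        ((((Quotient.out u : Gqs L v).val : GL (Fin 3) (UnitaryGroup.LocalRing L v)).val - 1) ^ n) := fun n => by
    rw [map_pow, map_sub, map_one, RingHom.mapMatrix_apply]; rfl
  have hinj : ∀ A : Matrix (Fin 3) (Fin 3) (UnitaryGroup.LocalRing L v),
      (Pi.evalRingHom (fun w' : PlacesOver L v => w'.1.adicCompletion L) w).mapMatrix A = 0 → A = 0 := fun A hA => by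
    refine Matrix.ext fun i j => ?_
    have hij := congr_fun (congr_fun hA i) j
    rw [RingHom.mapMatrix_apply, Matrix.map_apply, Matrix.zero_apply] at hij
    exact (apply_eq_zero_iff_apply_apply_eq_zero L v w hw (A i j)).2 hij
  have hn3 : ((((e (Quotient.out u) : ↥(unitaryGroupOfForm (galAdicCompletionMap (L := L) (IsCMField.complexConj L) hw) (placeForm (qsForm L) w.1))) :
        GL (Fin 3) (w.1.adicCompletion L)) : Matrix (Fin 3) (Fin 3) (w.1.adicCompletion L)) - 1) ^ 3 = 0 := by
    rw [hpow, hunip u hu, map_zero]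
  have hnil : IsNilpotent ((((e (Quotient.out u) : ↥(unitaryGroupOfForm (galAdicCompletionMap (L := L) (IsCMField.complexConj L) hw) (placeForm (qsForm L) w.1))) :
        GL (Fin 3) (w.1.adicCompletion L)) : Matrix (Fin 3) (Fin 3) (w.1.adicCompletion L)) - 1) := ⟨3, hn3⟩
  have hu₀U : (Quotient.out u : Gqs L v) ∈ U₀ := mem_of_isNilpotent hB e hU₀ hρ0 h2 hnil
  have hE : ∀ γ ∈ U₀, ∀ x : Gqs L v, Ψ (x * γ * x⁻¹) = x * Ψ γ * x⁻¹ := fun γ hγ x => map_conj_eq_conj_map hB e hU₀ hΨ hsρ hγ x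
  have hU' : ∀ x : Gqs L v, x * (Quotient.out u : Gqs L v) * x⁻¹ ∈ U₀ := conj_mem_of_isNilpotent hB e hU₀ hρ0 h2 hnil
  -- ### admissibility of `mU` at `u`, and a two-sided Haar measure on `Gqs L v`
  obtain ⟨hm0, hinv, hfin⟩ := hadm u (by show ConjClasses.mk (Quotient.out u : Gqs L v) ∈ S; rw [hmk]; exact hu)
  haveI : (Measure.haar : Measure (Gqs L v)).IsMulRightInvariant := isMulRightInvariant_cmDatum_local_antidiagOne L 3 v _
  -- ### the three branches
  by_cases hM1 : ((Quotient.out u : Gqs L v).val : GL (Fin 3) (UnitaryGroup.LocalRing L v)).val = 1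
  · -- IDENTITY CLASS: `u = [1]`, `a u = 0`
    have hu1 : u = ConjClasses.mk 1 := (hmk u).symm.trans (by rw [show (Quotient.out u : Gqs L v) = 1 from Subtype.ext (Units.ext hM1)])
    subst hu1
    have ha0 : a (ConjClasses.mk 1) = 0 := by rw [ha, if_pos]; rw [out_mk_one_eq_one]; rfl
    rw [ha0, pow_zero, one_mul]
    exact classOrbitalIntegral_indicator_comp_eq_of_mk_one (map_one_eq_one hB e hU₀ hΨ hρ0 h2) (one_mem hB e hU₀ hρ0 h2) mU F
  · -- the model-level instances and lattices shared by the two non-identity branches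
    letI : MeasurableSpace ↥(unitaryGroupOfForm (galAdicCompletionMap (L := L) (IsCMField.complexConj L) hw) (placeForm (qsForm L) w.1)) := borel _
    haveI : BorelSpace ↥(unitaryGroupOfForm (galAdicCompletionMap (L := L) (IsCMField.complexConj L) hw) (placeForm (qsForm L) w.1)) := ⟨rfl⟩
    haveI : CompactSpace 𝒪[w.1.adicCompletion L] := compactSpace_integer_adicCompletion L w.1
    have hne : (((e (Quotient.out u) : ↥(unitaryGroupOfForm (galAdicCompletionMap (L := L) (IsCMField.complexConj L) hw) (placeForm (qsForm L) w.1))) :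
        GL (Fin 3) (w.1.adicCompletion L)) : Matrix (Fin 3) (Fin 3) (w.1.adicCompletion L)) ≠ 1 := by
      intro h1
      apply hM1
      have h0 := hpow 1
      rw [pow_one, pow_one, h1, sub_self] at h0
      exact sub_eq_zero.1 (hinj _ h0.symm)
    obtain ⟨O, hO⟩ : ∃ O : AddSubgroup (w.1.adicCompletion L), ∀ x, x ∈ O ↔ Valued.v x ≤ 1 :=
      ⟨(Valued.v : Valuation (w.1.adicCompletion L) ℤᵐ⁰).leAddSubgroup 1, fun _ => Valuation.mem_leAddSubgroup_iff⟩
    obtain ⟨Op, hOp⟩ : ∃ Op : AddSubgroup (w.1.adicCompletion L), ∀ x, x ∈ Op ↔ galAdicCompletionMap (L := L) (IsCMField.complexConj L) hw x = x ∧ Valued.v x ≤ 1 :=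
      ⟨{ carrier := {x | galAdicCompletionMap (L := L) (IsCMField.complexConj L) hw x = x ∧ Valued.v x ≤ 1}
         add_mem' := fun {x y} hx hy => ⟨by rw [map_add, hx.1, hy.1], (Valuation.map_add _ x y).trans (max_le hx.2 hy.2)⟩
         zero_mem' := ⟨by rw [map_zero], by rw [map_zero]; exact zero_le⟩
         neg_mem' := fun {x} hx => ⟨by rw [map_neg, hx.1], by rw [Valuation.map_neg]; exact hx.2⟩ }, fun _ => Iff.rfl⟩
    obtain ⟨Om, hOm⟩ : ∃ Om : AddSubgroup (w.1.adicCompletion L), ∀ x, x ∈ Om ↔ galAdicCompletionMap (L := L) (IsCMField.complexConj L) hw x = -x ∧ Valued.v x ≤ 1 :=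
      ⟨{ carrier := {x | galAdicCompletionMap (L := L) (IsCMField.complexConj L) hw x = -x ∧ Valued.v x ≤ 1}
         add_mem' := fun {x y} hx hy => ⟨by rw [map_add, hx.1, hy.1, neg_add], (Valuation.map_add _ x y).trans (max_le hx.2 hy.2)⟩
         zero_mem' := ⟨by rw [map_zero, neg_zero], by rw [map_zero]; exact zero_le⟩
         neg_mem' := fun {x} hx => ⟨by rw [map_neg, hx.1], by rw [Valuation.map_neg]; exact hx.2⟩ }, fun _ => Iff.rfl⟩
    have hF1 := relIndex_map_mulLeft_eq_pow_place v w htk hO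
    have hFp := relIndex_map_mulLeft_fixedBall_sq_eq_pow (IsCMField.complexConj L) hc v w hw hσt htk hOp
    have hFm := relIndex_map_mulLeft_skewBall_eq_pow (IsCMField.complexConj L) hc v w hw hσt htk hOm
    by_cases hM2 : (((Quotient.out u : Gqs L v).val : GL (Fin 3) (UnitaryGroup.LocalRing L v)).val - 1) ^ 2 = 0
    · -- TRANSVECTION CLASS: `a u = 2`, rung C1 (the hypothesis `hC1`)
      have ha2 : a u = 2 := by rw [ha, if_neg hM1, if_pos hM2]
      have hsq : ((((e (Quotient.out u) : ↥(unitaryGroupOfForm (galAdicCompletionMap (L := L) (IsCMField.complexConj L) hw) (placeForm (qsForm L) w.1))) :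
            GL (Fin 3) (w.1.adicCompletion L)) : Matrix (Fin 3) (Fin 3) (w.1.adicCompletion L)) - 1) *
          ((((e (Quotient.out u) : ↥(unitaryGroupOfForm (galAdicCompletionMap (L := L) (IsCMField.complexConj L) hw) (placeForm (qsForm L) w.1))) :
            GL (Fin 3) (w.1.adicCompletion L)) : Matrix (Fin 3) (Fin 3) (w.1.adicCompletion L)) - 1) = 0 := by
        rw [← sq, hpow, hM2, map_zero]
      obtain ⟨h', hmat, hZ', K', hK'o, hK'c, ρ', hρ1, hρ2, hρ3, hr'⟩ :=
        hC1 (galAdicCompletionMap (L := L) (IsCMField.complexConj L) hw) hJw hσσ hσv h2 ht0 hσt ht1.le hO hOm hF1 hFm (e (Quotient.out u)) hsq hne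
      have hΨ' := map_eq_conj_of_coe_conj_eq e hΨ hu₀U hmat
      haveI := hρ1; haveI := hρ2; haveI := hρ3
      obtain ⟨h, Kc, ρ, hΨG, hZG, hKo, hKc, i1, i2, i3, hr⟩ := exists_scalingData_of_continuousMulEquiv e Ψ (Quotient.out u) hΨ' hZ' K' hK'o hK'c ρ' hr'
      haveI := i1; haveI := i2; haveI := i3
      rw [classOrbitalIntegral_indicator_comp_eq_mul_of_conj_of_index Ψ U₀ hE u hU' hΨG hZG Kc hKo hKc ρ hr Measure.haar mU hm0 hinv hfin F, ha2]
      congr 1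
      push_cast
      ring
    · -- REGULAR CLASS: `a u = 3`, rung C2
      have ha3 : a u = 3 := by rw [ha, if_neg hM1, if_neg hM2]
      have hreg : ((((e (Quotient.out u) : ↥(unitaryGroupOfForm (galAdicCompletionMap (L := L) (IsCMField.complexConj L) hw) (placeForm (qsForm L) w.1))) :
            GL (Fin 3) (w.1.adicCompletion L)) : Matrix (Fin 3) (Fin 3) (w.1.adicCompletion L)) - 1) ^ 2 ≠ 0 := by
        intro h0
        apply hM2
        rw [hpow] at h0
        exact hinj _ h0
      obtain ⟨h', hmat, hZ'⟩ := exists_conj_coe_eq_cayley_smul_of_regular_unipotent_of_eq (galAdicCompletionMap (L := L) (IsCMField.complexConj L) hw) hJw hσσ h2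
        (by rw [map_mul, hσt]) (mul_ne_zero ht0 ht0) (e (Quotient.out u)) hn3 hreg
      obtain ⟨π, hπ⟩ := HeightOneSpectrum.valuation_exists_uniformizer L w.1
      have hϖ : Valued.v ((π : L) : w.1.adicCompletion L) = WithZero.exp (-1 : ℤ) := by
        rw [HeightOneSpectrum.valuedAdicCompletion_eq_valuation', hπ]
      have hJdet : IsUnit (placeForm (qsForm L) w.1).det := by
        rw [hJw]; exact (Matrix.isUnit_iff_isUnit_det _).1 ((StdForm.antidiagonal 3).isUnit_over (w.1.adicCompletion L))
      obtain ⟨K', hK'o, hK'c, ρ', hρ1, hρ2, hρ3, hr'⟩ := exists_haar_index_identity_of_regular_unipotent (galAdicCompletionMap (L := L) (IsCMField.complexConj L) hw)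
        hϖ hσv hJdet h2 hσt ht0 ht1.le Op Om hOp hOm hFp hFm (e (Quotient.out u)) hn3 hreg h' hmat
      have hΨ' := map_eq_conj_of_coe_conj_eq e hΨ hu₀U hmat
      haveI := hρ1; haveI := hρ2; haveI := hρ3
      obtain ⟨h, Kc, ρ, hΨG, hZG, hKo, hKc, i1, i2, i3, hr⟩ := exists_scalingData_of_continuousMulEquiv e Ψ (Quotient.out u) hΨ' hZ' K' hK'o hK'c ρ' hr'
      haveI := i1; haveI := i2; haveI := i3
      rw [classOrbitalIntegral_indicator_comp_eq_mul_of_conj_of_index Ψ U₀ hE u hU' hΨG hZG Kc hKo hKc ρ hr Measure.haar mU hm0 hinv hfin F, ha3]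
      congr 1
      push_cast
      ring

/-- **DOCKING CERTIFICATE**: the head feeds ★ p855512 `psiPackage_of_scalingLaw` on the nose — ‹C1 Haar head, `2 ≠ 0` shape› ⟹ ‹Ψ-package› (the hypothesis of ★ p855276). -/
example (hC1 : ∀ {K : Type} [Field K] [Valued K ℤᵐ⁰] (σ : K →+* K) {J : Matrix (Fin 3) (Fin 3) K} [CompactSpace 𝒪[K]] [LocallyCompactSpace K]
      [MeasurableSpace ↥(unitaryGroupOfForm σ J)] [BorelSpace ↥(unitaryGroupOfForm σ J)],
      J = (StdForm.antidiagonal 3).over K → (∀ a : K, σ (σ a) = a) → (∀ a : K, Valued.v (σ a) = Valued.v a) → (2 : K) ≠ 0 →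
      ∀ {t : K}, t ≠ 0 → σ t = t → Valued.v t ≤ 1 →
      ∀ {O : AddSubgroup K}, (∀ x : K, x ∈ O ↔ Valued.v x ≤ 1) → ∀ {Om : AddSubgroup K}, (∀ x : K, x ∈ Om ↔ σ x = -x ∧ Valued.v x ≤ 1) →
      ∀ {Q : ℕ}, (O.map (AddMonoidHom.mulLeft t)).relIndex O = Q → (Om.map (AddMonoidHom.mulLeft (t * t))).relIndex Om = Q →
      ∀ (u₀ : ↥(unitaryGroupOfForm σ J)), (((u₀ : GL (Fin 3) K) : Matrix (Fin 3) (Fin 3) K) - 1) * (((u₀ : GL (Fin 3) K) : Matrix (Fin 3) (Fin 3) K) - 1) = 0 → ((u₀ : GL (Fin 3) K) : Matrix (Fin 3) (Fin 3) K) ≠ 1 →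
      ∃ h : ↥(unitaryGroupOfForm σ J),
        (((h * u₀ * h⁻¹ : ↥(unitaryGroupOfForm σ J)) : GL (Fin 3) K) : Matrix (Fin 3) (Fin 3) K) = cayley ((t * t) • ((((u₀ : GL (Fin 3) K) : Matrix (Fin 3) (Fin 3) K) - 1) * (((u₀ : GL (Fin 3) K) : Matrix (Fin 3) (Fin 3) K) + 1)⁻¹)) ∧
        (∀ z : ↥(unitaryGroupOfForm σ J), z ∈ Subgroup.centralizer ({u₀} : Set ↥(unitaryGroupOfForm σ J)) ↔
          h * z * h⁻¹ ∈ Subgroup.centralizer ({u₀} : Set ↥(unitaryGroupOfForm σ J))) ∧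
        ∃ K₀ : Subgroup ↥(unitaryGroupOfForm σ J), IsOpen (K₀ : Set ↥(unitaryGroupOfForm σ J)) ∧ IsCompact (K₀ : Set ↥(unitaryGroupOfForm σ J)) ∧
          ∃ ρ : Measure ↥(Subgroup.centralizer ({u₀} : Set ↥(unitaryGroupOfForm σ J))),
            ρ.IsMulLeftInvariant ∧ IsFiniteMeasureOnCompacts ρ ∧ ρ.IsOpenPosMeasure ∧
            (((Q : ℝ≥0) ^ 2 : ℝ≥0) : ℝ≥0∞) * ρ (Subtype.val ⁻¹' ((K₀.map (MulAut.conj h).toMonoidHom : Subgroup ↥(unitaryGroupOfForm σ J)) : Set ↥(unitaryGroupOfForm σ J))) =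
              ρ (Subtype.val ⁻¹' (K₀ : Set ↥(unitaryGroupOfForm σ J)))) : True :=
  (fun _ => trivial) (psiPackage_of_scalingLaw (scalingLaw_of_transvectionHaar hC1))

end Summit.HodgeConjecture.HodgeConjecture.Cruxes.H413.K2E3UnipotentOrbitalScalingLawOfNeZero

end
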